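import Mathlib
import Summits.NavierStokesRegularity.NavierStokesRegularity.Theorems.EulerZoomLiouvillePowerGaugeEulerLiouvilleChannelClock
import Summits.NavierStokesRegularity.NavierStokesRegularity.Theorems.EulerZoomLiouvillePowerGaugeEulerLiouvilleNeedleWaitingTimeMember
import Summits.NavierStokesRegularity.NavierStokesRegularity.Theorems.EulerZoomLiouvillePowerGaugeEulerLiouvilleCondenserMinimalType
import HarnessLib

/-!
# «ANY FAST CHANNEL KILLS», II (member level): the threshold of `HasFastVorticalChannel` drops from `1/((2+ρ)(1+ρ))` to `0`
# (crux `EulerZoomLiouville.PowerGaugeEulerLiouville` = stmt-NavierStokesRegularity-19832, THE ONE STATEMENT `stub_selfSimilarC2Needle`)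

Route `EulerZoomLiouville` (NavierStokesRegularity), crux E, LEAD seat ns-typeII-p2 g13 (own brick).  By-name assembly of

* the class-free clock `ChannelClock.logClock_of_channel` (this seat, `…ChannelClock`): a one-sided vortical Bernoulli channel at ANY rate
  `c₁ > 0` is a LOG RESIDENCE CLOCK with `s₁ = 1/c₁ + 2`, and
* ns-ezl-w2 g3's threshold `NeedleRace.selfSimilar_ae_eq_zero_of_logClockC2` (`…NeedleWaitingTimeMember`, ROUND-38 (W)): EVERY log clock kills an
  exactly self-similar `C²` member (waiting-time law at `m = 6γs₁ + 2` on the super-polynomially thin fast exits (K′)),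

over a classical pressure of the profile (`WeakToClassical.exists_isSelfSimilarEulerProfile_of_contDiff`):

* **`Loc.selfSimilar_ae_eq_zero_of_vorticalChannelC2_profile_anyRate`** — the hypotheses of ns-ezl-w5 g2's
  `Loc.selfSimilar_ae_eq_zero_of_vorticalFastChannelC2_profile_free` (p645615) VERBATIM with the rate condition `1/((2+ρ)(1+ρ)) < c₁`
  REPLACED BY `0 < c₁`: crux hypotheses (`0 < ρ ≤ ½`), exact self-similarity about the origin with a `C²` profile `V`, and for ONE `c₁ > 0`,
  every classical pressure `P′` and every level `h` a radius beyond which every VORTICAL point of `{ℋ_{P′} > h}` has `⟪y, γy + V y⟫ ≤ −c₁‖y‖²`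
  ⇒ `u = 0` a.e. on the slab.

For the skeleton (LEAD, v83): in `HasFastVorticalChannel ρ V` the conjunct `1 / ((2 + ρ) * (1 + ρ)) < c₁` becomes `0 < c₁` (filler: this theorem,
same remaining arguments).  THE ONE STATEMENT's (N3′) residue becomes «for EVERY `c₁ > 0`, some classical pressure and level admit, beyond every
radius, VORTICAL Bernoulli-high points with inflow excess `s − γ < c₁`» — the needle's slow points are CRITICALLY slow (radial rate `≤ γ + o(1)`),
not merely below the Sobolev race threshold.
WHAT THIS IS NOT: not NS, not E — a stratum of THE ONE STATEMENT on the model lattice; DENT 0 on the registered stubs; 19832 OPEN; NS regularity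
is NOT proved. [folklore; ConstantinIgnatovaVicol2026Putative §3.4–§3.5]
-/

noncomputable section

-- flat `Theorems/<Route><Decl>…` files of one crux share the namespace of the crux (tree convention: `Summit.<S>.<S>.…`)
set_option linter.dupNamespace false

open Set Filter Topology Metric Function MeasureTheory
open scoped RealInnerProductSpace NNReal ENNReal

namespace Summit.NavierStokesRegularity.NavierStokesRegularity.Theorems.PowerGaugeEulerLiouville

open Literature.Analysis Literature.Analysis.FluidPDE

/-- **EXACTLY SELF-SIMILAR MEMBERS WHOSE `C²` PROFILE HAS A FAR ONE-SIDED VORTICAL BERNOULLI CHANNEL AT ANY RATE `c₁ > 0` ARE TRIVIAL**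
(crux hypotheses verbatim, `0 < ρ ≤ ½`, `γ = 1/(2+ρ)`; exact self-similarity about the origin; `V ∈ C²`; for every classical pressure `P′` and
every level `h` a radius beyond which every VORTICAL point of `{ℋ_{P′} > h}` has `⟪y, γy + V y⟫ ≤ −c₁‖y‖²`).  = ns-ezl-w5 g2's
`Loc.selfSimilar_ae_eq_zero_of_vorticalFastChannelC2_profile_free` with `1/((2+ρ)(1+ρ)) < c₁` weakened to `0 < c₁`; proof = channel ⇒ log
residence clock (`ChannelClock.logClock_of_channel`) ⇒ trivial (`NeedleRace.selfSimilar_ae_eq_zero_of_logClockC2`).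
[folklore; ConstantinIgnatovaVicol2026Putative §3.4–§3.5] -/
theorem Loc.selfSimilar_ae_eq_zero_of_vorticalChannelC2_profile_anyRate {ρ : ℝ} (hρ : 0 < ρ) (hρ1 : ρ ≤ 1 / 2)
    {u : ℝ → EuclideanSpace ℝ (Fin 3) → EuclideanSpace ℝ (Fin 3)} {p : ℝ → EuclideanSpace ℝ (Fin 3) → ℝ}
    {H : ℝ → EuclideanSpace ℝ (Fin 3) → EuclideanSpace ℝ (Fin 3) →L[ℝ] EuclideanSpace ℝ (Fin 3)} {c : ℝ≥0}
    (hsw : IsSuitableWeakSolutionOn (slab (EuclideanSpace ℝ (Fin 3)) (Iio 0) isOpen_Iio) 0 0 u p)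
    (hH : HasWeakSpatialGradientOn (slab (EuclideanSpace ℝ (Fin 3)) (Iio 0) isOpen_Iio) u H)
    (hgauge : ∀ a : ℝ, 0 < a →
      ENNReal.ofReal (a ^ (2 * ρ)) * cknA a (0 : ℝ × EuclideanSpace ℝ (Fin 3)) u +
          ENNReal.ofReal (a ^ ρ) * cknE a (0 : ℝ × EuclideanSpace ℝ (Fin 3)) H +
        ENNReal.ofReal (a ^ (2 * ρ)) * cknD a (0 : ℝ × EuclideanSpace ℝ (Fin 3)) p ≤ (c : ℝ≥0∞))
    {V : EuclideanSpace ℝ (Fin 3) → EuclideanSpace ℝ (Fin 3)} {P : EuclideanSpace ℝ (Fin 3) → ℝ}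
    (hu : ∀ τ : ℝ, τ < 0 → u τ = selfSimilarCollapse (1 / (2 + ρ)) 0 V τ)
    (hp : ∀ τ : ℝ, τ < 0 → p τ = selfSimilarCollapsePressure (1 / (2 + ρ)) 0 P τ)
    (hV : ContDiff ℝ 2 V) {c₁ : ℝ} (hc₁ : 0 < c₁)
    (hB : ∀ P' : EuclideanSpace ℝ (Fin 3) → ℝ, IsSelfSimilarEulerProfile (1 / (2 + ρ)) 0 V P' →
      ∀ h : ℝ, ∃ R₀ : ℝ, ∀ y : EuclideanSpace ℝ (Fin 3), R₀ ≤ ‖y‖ →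
        h < selfSimilarBernoulli (1 / (2 + ρ)) 0 V P' y → curl V y ≠ 0 →
          ⟪y, selfSimilarTransport (1 / (2 + ρ)) 0 V y⟫ ≤ -(c₁ * ‖y‖ ^ 2)) :
    uncurry u =ᵐ[volume.restrict (Iio (0 : ℝ) ×ˢ (univ : Set (EuclideanSpace ℝ (Fin 3))))] 0 := by
  have hρ1' : ρ < 1 := by linarith
  -- ### a classical pressure for the profile
  have hD : ∀ a : ℝ, 0 < a → ENNReal.ofReal (a ^ (2 * ρ)) *
      cknD a (0 : ℝ × EuclideanSpace ℝ (Fin 3)) p ≤ (c : ℝ≥0∞) :=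
    fun a ha => le_trans le_add_self (hgauge a ha)
  have hpm : AEStronglyMeasurable (uncurry p)
      (volume.restrict (Iio (0 : ℝ) ×ˢ (univ : Set (EuclideanSpace ℝ (Fin 3))))) := by
    have := hsw.distributional.2.2.1.aestronglyMeasurable
    simpa [slab] using this
  have hPm := aestronglyMeasurable_pressureProfile hpm hp
  have hDprof := profile_pressure_weight_of_gaugeD hρ hρ1' hpm hp hD
  have hP1 : LocallyIntegrable P volume :=
    EnergySaturation.locallyIntegrable_pressure_of_weight hρ1' hPm
      (ENNReal.mul_ne_top ENNReal.ofReal_ne_top ENNReal.coe_ne_top) hDprof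
  obtain ⟨P', hprof⟩ :=
    WeakToClassical.exists_isSelfSimilarEulerProfile_of_contDiff hsw.distributional hu hp hV hP1
  -- ### the channel is a log residence clock with `s₁ = 1/c₁ + 2`
  have hclock := ChannelClock.logClock_of_channel hρ hρ1 hprof hc₁ (hB P' hprof)
  have hs₁ : (0 : ℝ) ≤ 1 / c₁ + 2 := by positivity
  -- ### every log clock kills
  exact NeedleRace.selfSimilar_ae_eq_zero_of_logClockC2 hρ hρ1 hsw hH hgauge hu hp hV hs₁ hclock

end Summit.NavierStokesRegularity.NavierStokesRegularity.Theorems.PowerGaugeEulerLiouville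

end
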